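import Summits.BirchSwinnertonDyer.BirchSwinnertonDyer.Theorems.GenusKolyvaginAtTwoPowDvdShaCardAtTwoRTOrthogonalLadders
import Summits.BirchSwinnertonDyer.BirchSwinnertonDyer.Theorems.GenusKolyvaginAtTwoPowDvdShaCardAtTwoRTRungFamilies
import Summits.BirchSwinnertonDyer.BirchSwinnertonDyer.Theorems.GenusKolyvaginAtTwoPowDvdShaCardAtTwoRTRungDescent
import Summits.BirchSwinnertonDyer.BirchSwinnertonDyer.Theorems.GenusKolyvaginAtTwoCasselsTateNumberField
import Literature.NumberTheory.EllipticCurves.SelmerGaloisAction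
import Literature.NumberTheory.EllipticCurves.SelmerFiniteProofs
import Literature.NumberTheory.EllipticCurves.PeriodIndexCassels
import HarnessLib

/-!
# Route `GenusKolyvaginAtTwo`, LINE 18 (L_T `PowDvdShaCardAtTwoRT`, stmt-BirchSwinnertonDyer-23299, ex 23242) — THE K-SIDE CAPSTONE
# OF ROAD (E4): `2^{2M₀} ∣ #Ш(E_K)[2^∞]` from Kolyvagin's depth supplies KEPT BY PROVENANCE and ONE displayed socket —
# Cassels–Tate ORTHOGONALITY of the (+)- and (−)-provenance classes (X-ORTH) — with no twin, no descent to `ℚ`, no genus budget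

Seat `bsd-line-gk2-p2` g20 (PROVER seat 2/3, cell `bsd-f1-sign2`), `--supports stmt-BirchSwinnertonDyer-23299` (helper; closes
nothing). THEOREMS ONLY (no definition, no named fact, no `sorry`); BSD is not proved by any of this; neither is L_T.

WHY (gk2-p4 g20 memo `Cruxes/PowDvdShaCardAtTwoRT/Lines/plus-descent-deep-orthogonality-gk2p4.md` §3(c)(iii), §7(b)). gk2-p4's count
`pow_two_mul_dvd_natCard_sha_of_orthogonal_ladders_of_dvd_two` (p735742) turns two ladders of INDEPENDENT classes inside two subgroups
`U, U′ ≤ Ш(E_K)[2^k]` that are ORTHOGONAL under a bi-additive `B` with the Cassels–Tate level-kernel clause into L_T's conclusion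
`2^{2·M 0} ∣ #Ш(E_K)[2^∞]` verbatim.  This file is the plumbing from KOLYVAGIN'S SUPPLIES to those ladders, over `K` (my lineage's ℚ-side
capstone `twinShaLadders_of_depth_supplies` p707080/p708383 did the same job through the twin `Wd` and the `±`-descent to `ℚ`):

* §1 two group lemmas: a finite subgroup whose non-zero elements coincide has order `∣ 2`; a cyclic `2`-group has at most one
  non-zero element killed by `2` (its socle, `exists_two_pow_smul_eq_socle`).
* §2 **`pow_dvd_natCard_sha_of_depth_supplies_of_orthogonal`** — THE ABSTRACT-FRAME CAPSTONE.  Frame at level `2^L` over `K` with an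
  automorphism `σ` (complex conjugation): `g` generating `E(K)` modulo `2^L` whose Kummer class has sign `−w` (`w = ±1`; the Mordell–Weil
  line: `y_K` has sign `−w(E)`, Gross Prop. 5.3), `P₀ ∈ E(K)` with `2^L ∤ P₀` (`P₀ = y_K`, `L > M₀`); depth minima `Mr` (antitone,
  `Mr 0 = M₀`, `Mr R = 0`) with `M₀ ≤ k`; PROVENANCE predicates `Pp`, `Pm` on `H¹(K, E[2^L])` (whatever the supplier records about its
  classes — intended: «`= 2^{L−e} c_L(n)` for a Kolyvagin datum at a level `n` of the right parity, own-prime vanishing, …»); McCallum-shaped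
  supplies at every depth with a positive drop — odd depths: among Selmer classes of sign `w`, budget `2m+1`, no seed, the supplied class
  satisfying `Pp`; even depths: sign `−w`, seed `⟨δ(P₀)⟩`, the supplied class satisfying `Pm` —; a bi-additive `B` on `Ш(E_K)[2^k]` into
  `ℚ/ℤ` with the level clause «`B(x,·) = 0 ⟹ x ∈ 2^k Ш`»; and THE SOCKET X-ORTH: `B(x, x′) = 0` whenever `x` is the image of a Selmer class
  with `Pp` and `x′` of one with `Pm`.  THEN `2^{2M₀} ∣ #Ш(E_K)[2^∞]`.  Mechanism: the (+)-ladder is built UPSTAIRS in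
  `Sel^{(2^L)} ⊓ H¹[2^k]` by the greedy lemma (`exists_indepFamilyMod_of_forall_exists_avoiding`, seed `⊥`) and mapped to `Ш[2^k]`; the kernel of
  that map is the Kummer line `⟨δ g⟩` (`mem_zmultiples_kummer_of_torsionH1ToH1_eq_zero`), of sign `−w`, while the (+)-span has sign `w`, so
  the kernel meets the span inside the `2`-torsion of a cyclic `2`-group: `#(ker ⊓ U₁) ∣ 2` (§1) — the `δE(K)`-bit, refunded by Cassels–Tate
  evenness (`isSquare_natCard_primaryComponent_sha`); the (−)-ladder is built with the seed `⟨δ(P₀)⟩` and pushed DOWN to `Ш[2^k]` without loss by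
  the socle lemma `sum_zsmul_eq_zero_of_torsionH1ToH1_eq_zero_of_disjoint_kummer`; orthogonality passes to spans
  (`forall_mem_closure_apply_eq_zero`); if `Ш(E_K)[2^∞]` is infinite the conclusion is `2^{2M₀} ∣ 0`.  NO root-number case split (both
  parities stay over `K`), no `Δ < 0`, no `Wd`, no genus budget `B`.
  What stays displayed: X-ORTH (gk2-p4's socket: McCallum Prop. 4.7 + the cross-sign local vanishing p736279) and the level pairing `B`
  (the tree's canonical `ctLevelPairing`, `isLevelPairing_ctLevelPairing_canonical`) — instantiated by the LEAD / gk2-p4, not here.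

References: [McCallumLMS1991] §4 Prop. 4.7, §5 Prop. 5.2, Lemma 5.3, Thm. 5.4 (p. 310); [Kolyvagin1991StructureSha]; [GrossLMS1991] §5
Prop. 5.3–5.4; [MilneADT2006] Ch. I §6 Lemma 6.17; [SilvermanAEC2009] Thm. X.4.2, X.4.14.
-/

set_option autoImplicit false
-- the Theorems namespace of this sub repeats the summit name by design (D-0017 nested layout)
set_option linter.dupNamespace false

noncomputable section

open scoped Classical
open scoped AddSubgroup

namespace Summit.BirchSwinnertonDyer.BirchSwinnertonDyer.Theorems.GenusExact.PlusDescent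

open WeierstrassCurve NumberField Field Literature.NumberTheory.EllipticCurves
  Literature.NumberTheory.GaloisRepresentations AddSubgroup

/-! ## §1 Two group lemmas -/

section Helpers

variable {A : Type*} [AddCommGroup A]

/-- A finite subgroup all of whose non-zero elements coincide has order dividing `2`. [folklore] -/
theorem natCard_dvd_two_of_forall_eq (H : AddSubgroup A) [Finite H]
    (h : ∀ x ∈ H, ∀ y ∈ H, x ≠ 0 → y ≠ 0 → x = y) : Nat.card H ∣ 2 := by
  have hinj : Function.Injective (fun x : H ↦ decide ((x : A) = 0)) := by
    intro x y hxy
    by_cases hx : (x : A) = 0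
    · by_cases hy : (y : A) = 0
      · exact Subtype.ext (hx.trans hy.symm)
      · simp [hx, hy] at hxy
    · by_cases hy : (y : A) = 0
      · simp [hx, hy] at hxy
      · exact Subtype.ext (h x x.2 y y.2 hx hy)
  have hle : Nat.card H ≤ 2 := by
    have h2 := Nat.card_le_card_of_injective _ hinj
    simpa using h2
  have hpos : 0 < Nat.card H := Nat.card_pos
  obtain ⟨n, hn⟩ : ∃ n, Nat.card H = n := ⟨_, rfl⟩
  rw [hn] at hle hpos ⊢
  interval_cases n <;> norm_num

/-- In a cyclic `2`-group `⟨κ⟩` there is at most one non-zero element killed by `2` (the socle `2^{c−1} κ`). [folklore] -/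
theorem eq_of_two_nsmul_eq_zero_of_mem_zmultiples {κ x y : A} {c : ℕ} (hκ : addOrderOf κ = 2 ^ c)
    (hx : x ∈ zmultiples κ) (hy : y ∈ zmultiples κ) (hx0 : x ≠ 0) (hy0 : y ≠ 0)
    (hx2 : 2 • x = 0) (hy2 : 2 • y = 0) : x = y := by
  have hc : c ≠ 0 := by
    rintro rfl
    rw [pow_zero, AddMonoid.addOrderOf_eq_one_iff] at hκ
    rw [hκ, zmultiples_zero_eq_bot, mem_bot] at hx
    exact hx0 hx
  have hsoc : (2 ^ (c - 1)) • κ ≠ 0 := by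
    intro h0
    have hdvd : addOrderOf κ ∣ 2 ^ (c - 1) := addOrderOf_dvd_iff_nsmul_eq_zero.mpr h0
    rw [hκ, Nat.pow_dvd_pow_iff_le_right (by norm_num)] at hdvd
    omega
  have key : ∀ z ∈ zmultiples κ, z ≠ 0 → 2 • z = 0 → z = 2 ^ (c - 1) • κ := by
    intro z hz hz0 hz2
    obtain ⟨j, hj⟩ := exists_two_pow_smul_eq_socle hκ hz hz0
    rcases Nat.eq_zero_or_pos j with rfl | hj0
    · simpa using hj
    · exfalso
      apply hsoc
      rw [← hj, ← Nat.sub_add_cancel hj0, pow_succ, mul_smul, hz2, smul_zero]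
  exact (key x hx hx0 hx2).trans (key y hy hy0 hy2).symm

end Helpers

/-! ## §2 The K-side capstone over the abstract frame -/

variable (W : WeierstrassCurve ℚ) [W.IsElliptic] (K : Type) [Field K] [NumberField K] (σ : K ≃ₐ[ℚ] K) (L k : ℕ)

/-- **L_T's CONCLUSION, K-SIDE, FROM DEPTH SUPPLIES WITH PROVENANCE + ORTHOGONALITY (road (E4)).**  See the module docstring for the
frame.  Hypotheses, in order: `2^L`-divisibility of `E(K̄)` (`hdiv`); a point `g` generating `E(K)` modulo `2^L` whose Kummer class is a
`(−w)`-eigenvector of `σ` (`w = ±1`); `P₀ ∈ E(K)` not `2^L`-divisible; provenance predicates `Pp`, `Pm`; a bi-additive `B` on `Ш(E_K)[2^k]`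
into `ℚ/ℤ` with the level clause; X-ORTH (`B` kills «`Pp`-image × `Pm`-image»); minima `Mr` (antitone, `Mr 0 = M₀ ≤ k`, `Mr R = 0`); the odd-depth
supplies (sign `w`, budget `2m+1`, no seed, output with `Pp`) and the even-depth supplies (sign `−w`, seed `⟨δ(P₀)⟩`, output with `Pm`).
Conclusion: `2^{2M₀} ∣ #Ш(E_K)[2^∞]` (`Nat.card`; trivial if the group is infinite).
[cite: McCallumLMS1991, §4 Prop. 4.7, §5 Prop. 5.2, Thm. 5.4 (p. 310)] [cite: Kolyvagin1991StructureSha] [cite: SilvermanAEC2009, Thm. X.4.2, X.4.14] -/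
theorem pow_dvd_natCard_sha_of_depth_supplies_of_orthogonal
    (hdiv : ∀ P : geomPoints (W.baseChange K), ∃ Q : geomPoints (W.baseChange K), ((2 ^ L : ℕ) : ℤ) • Q = P)
    (g : (W.baseChange K).toAffine.Point)
    (hg : ∀ P : (W.baseChange K).toAffine.Point, ∃ (c : ℤ) (Q : (W.baseChange K).toAffine.Point),
      ((2 ^ L : ℕ) : ℤ) • Q = P - c • g)
    (w : ℤ) (hw : w = 1 ∨ w = -1)
    (hκ : conjAct W σ ((2 ^ L : ℕ) : ℤ) (kummerMapTorsion (W.baseChange K) ((2 ^ L : ℕ) : ℤ) hdiv g) =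
      (-w) • kummerMapTorsion (W.baseChange K) ((2 ^ L : ℕ) : ℤ) hdiv g)
    (P₀ : (W.baseChange K).toAffine.Point) (hP₀ : ∀ Q : (W.baseChange K).toAffine.Point, ((2 ^ L : ℕ) : ℤ) • Q ≠ P₀)
    (Pp Pm : galH1Torsion (W.baseChange K) ((2 ^ L : ℕ) : ℤ) → Prop)
    (B : ↥((↥(W.baseChange K).sha)[((2 ^ k : ℕ) : ℤ)]) →+ ↥((↥(W.baseChange K).sha)[((2 ^ k : ℕ) : ℤ)]) →+ AddCircle (1 : ℚ))
    (hker : ∀ x : ↥((↥(W.baseChange K).sha)[((2 ^ k : ℕ) : ℤ)]), B x = 0 →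
      ∃ z : (W.baseChange K).sha, (2 ^ k) • z = (x : (W.baseChange K).sha))
    (hOrth : ∀ x x' : ↥((↥(W.baseChange K).sha)[((2 ^ k : ℕ) : ℤ)]),
      (∃ y, y ∈ selmerGroup (W.baseChange K) ((2 ^ L : ℕ) : ℤ) ∧ Pp y ∧
        ((x : (W.baseChange K).sha) : (W.baseChange K).galH1) = torsionH1ToH1 (W.baseChange K) ((2 ^ L : ℕ) : ℤ) y) →
      (∃ y', y' ∈ selmerGroup (W.baseChange K) ((2 ^ L : ℕ) : ℤ) ∧ Pm y' ∧
        ((x' : (W.baseChange K).sha) : (W.baseChange K).galH1) = torsionH1ToH1 (W.baseChange K) ((2 ^ L : ℕ) : ℤ) y') →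
      B x x' = 0)
    (M₀ R : ℕ) (Mr : ℕ → ℕ) (hMr : ∀ j, Mr (j + 1) ≤ Mr j) (hMr0 : Mr 0 = M₀) (hMrR : Mr R = 0) (hkM : M₀ ≤ k)
    (hsupOdd : ∀ m : ℕ, Mr (2 * m + 1) < Mr (2 * m) →
      ∀ i < 2 * m + 2, ∀ u : Fin i → galH1Torsion (W.baseChange K) ((2 ^ L : ℕ) : ℤ),
      (∀ j, u j ∈ selmerGroup (W.baseChange K) ((2 ^ L : ℕ) : ℤ) ∧
        conjAct W σ ((2 ^ L : ℕ) : ℤ) (u j) = w • u j) →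
      (∀ j, addOrderOf (u j) = 2 ^ (Mr (2 * m) - Mr (2 * m + 1))) →
      ∃ y : galH1Torsion (W.baseChange K) ((2 ^ L : ℕ) : ℤ),
        (y ∈ selmerGroup (W.baseChange K) ((2 ^ L : ℕ) : ℤ) ∧ conjAct W σ ((2 ^ L : ℕ) : ℤ) y = w • y) ∧ Pp y ∧
        addOrderOf y = 2 ^ (Mr (2 * m) - Mr (2 * m + 1)) ∧ Disjoint (zmultiples y) (AddSubgroup.closure (Set.range u)))
    (hsupEven : ∀ m : ℕ, Mr (2 * m + 2) < Mr (2 * m + 1) →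
      ∀ i < 2 * m + 2, ∀ u : Fin i → galH1Torsion (W.baseChange K) ((2 ^ L : ℕ) : ℤ),
      (∀ j, u j ∈ selmerGroup (W.baseChange K) ((2 ^ L : ℕ) : ℤ) ∧
        conjAct W σ ((2 ^ L : ℕ) : ℤ) (u j) = (-w) • u j) →
      (∀ j, addOrderOf (u j) = 2 ^ (Mr (2 * m + 1) - Mr (2 * m + 2))) →
      ∃ y : galH1Torsion (W.baseChange K) ((2 ^ L : ℕ) : ℤ),
        (y ∈ selmerGroup (W.baseChange K) ((2 ^ L : ℕ) : ℤ) ∧ conjAct W σ ((2 ^ L : ℕ) : ℤ) y = (-w) • y) ∧ Pm y ∧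
        addOrderOf y = 2 ^ (Mr (2 * m + 1) - Mr (2 * m + 2)) ∧
        Disjoint (zmultiples y) (AddSubgroup.closure (Set.range u) ⊔
          zmultiples (kummerMapTorsion (W.baseChange K) ((2 ^ L : ℕ) : ℤ) hdiv P₀))) :
    2 ^ (2 * M₀) ∣ Nat.card (AddCommGroup.primaryComponent (W.baseChange K).sha 2) := by
  -- if `Ш(E_K)[2^∞]` is infinite the conclusion is `∣ 0`
  by_cases hfin : Finite (AddCommGroup.primaryComponent (W.baseChange K).sha 2)
  swap
  · rw [not_finite_iff_infinite] at hfin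
    rw [Nat.card_eq_zero_of_infinite]
    exact dvd_zero _
  haveI := hfin
  haveI hell : (W.baseChange K).IsElliptic := inferInstanceAs ((W.map (algebraMap ℚ K)).IsElliptic)
  haveI : Fact (Nat.Prime 2) := ⟨Nat.prime_two⟩
  have hN : ((2 ^ L : ℕ) : ℤ) ≠ 0 := by positivity
  -- antitonicity in the large
  have hanti : ∀ a b, a ≤ b → Mr b ≤ Mr a := fun a b hab ↦ by
    induction hab with
    | refl => exact le_rfl
    | step _ ih => exact (hMr _).trans ih
  have hMr2R : Mr (2 * R) = 0 := Nat.eq_zero_of_le_zero (hMrR ▸ hanti R (2 * R) (by omega))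
  have hMrle : ∀ j, Mr j ≤ k := fun j ↦ ((hanti 0 j (Nat.zero_le j)).trans hMr0.le).trans hkM
  -- Cassels–Tate: `v₂ #Ш[2^∞]` is even
  have heven : Even (padicValNat 2 (Nat.card (AddCommGroup.primaryComponent (W.baseChange K).sha 2))) := by
    obtain ⟨r, hr⟩ := CasselsTateNumberField.isSquare_natCard_primaryComponent_sha (W.baseChange K) 2
    have hr0 : r ≠ 0 := fun h0 ↦
      (Nat.card_pos (α := AddCommGroup.primaryComponent (W.baseChange K).sha 2)).ne' (by rw [hr, h0, mul_zero])
    rw [hr, padicValNat.mul hr0 hr0]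
    exact ⟨_, rfl⟩
  /- the upstairs group `S₁ = Sel^{(2^L)} ⊓ H¹[2^k]` and the map `f : S₁ → Ш[2^k]` -/
  let S₁ : AddSubgroup (galH1Torsion (W.baseChange K) ((2 ^ L : ℕ) : ℤ)) :=
    selmerGroup (W.baseChange K) ((2 ^ L : ℕ) : ℤ) ⊓ (galH1Torsion (W.baseChange K) ((2 ^ L : ℕ) : ℤ))[((2 ^ k : ℕ) : ℤ)]
  haveI : Finite (selmerGroup (W.baseChange K) ((2 ^ L : ℕ) : ℤ)) := (W.baseChange K).finite_selmerGroup_holds hN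
  haveI hS₁fin : Finite S₁ := Finite.of_injective _ (AddSubgroup.inclusion_injective (inf_le_left (a := selmerGroup _ ((2 ^ L : ℕ) : ℤ))))
  have hsha : ∀ x : S₁, torsionH1ToH1 (W.baseChange K) ((2 ^ L : ℕ) : ℤ) (x : galH1Torsion (W.baseChange K) ((2 ^ L : ℕ) : ℤ)) ∈ (W.baseChange K).sha :=
    fun x ↦ torsionH1ToH1_mem_sha_of_mem_selmerGroup (W.baseChange K) hN x.2.1
  let f₀ : S₁ →+ (W.baseChange K).sha :=
    ((torsionH1ToH1 (W.baseChange K) ((2 ^ L : ℕ) : ℤ)).comp S₁.subtype).codRestrict _ hsha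
  have htor : ∀ x : S₁, f₀ x ∈ (↥(W.baseChange K).sha)[((2 ^ k : ℕ) : ℤ)] := fun x ↦ by
    refine mem_torsionBy_iff.mpr (Subtype.ext ?_)
    have hx : ((2 ^ k : ℕ) : ℤ) • (x : galH1Torsion (W.baseChange K) ((2 ^ L : ℕ) : ℤ)) = 0 := mem_torsionBy_iff.mp x.2.2
    rw [AddSubgroupClass.coe_zsmul, ZeroMemClass.coe_zero]
    change ((2 ^ k : ℕ) : ℤ) • torsionH1ToH1 (W.baseChange K) ((2 ^ L : ℕ) : ℤ) x = 0
    rw [← map_zsmul, hx, map_zero]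
  let f : S₁ →+ ↥((↥(W.baseChange K).sha)[((2 ^ k : ℕ) : ℤ)]) := f₀.codRestrict _ htor
  have hf : ∀ x : S₁, (((f x : ↥((↥(W.baseChange K).sha)[((2 ^ k : ℕ) : ℤ)])) : (W.baseChange K).sha) :
      (W.baseChange K).galH1) = torsionH1ToH1 (W.baseChange K) ((2 ^ L : ℕ) : ℤ) x := fun _ ↦ rfl
  have hfker : ∀ x : S₁, f x = 0 → torsionH1ToH1 (W.baseChange K) ((2 ^ L : ℕ) : ℤ) x = 0 := fun x hx ↦ by
    rw [← hf x, hx]; rfl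
  /- the spans: `U₁` upstairs (sign `w`, provenance `Pp`), `U`, `U'` downstairs -/
  let U₁ : AddSubgroup S₁ := AddSubgroup.closure
    {x : S₁ | conjAct W σ ((2 ^ L : ℕ) : ℤ) (x : galH1Torsion (W.baseChange K) ((2 ^ L : ℕ) : ℤ)) = w • (x : galH1Torsion (W.baseChange K) ((2 ^ L : ℕ) : ℤ)) ∧ Pp x}
  let genP : Set ↥((↥(W.baseChange K).sha)[((2 ^ k : ℕ) : ℤ)]) := {x | ∃ y, y ∈ selmerGroup (W.baseChange K) ((2 ^ L : ℕ) : ℤ) ∧ Pp y ∧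
    ((x : (W.baseChange K).sha) : (W.baseChange K).galH1) = torsionH1ToH1 (W.baseChange K) ((2 ^ L : ℕ) : ℤ) y}
  let genM : Set ↥((↥(W.baseChange K).sha)[((2 ^ k : ℕ) : ℤ)]) := {x | ∃ y, y ∈ selmerGroup (W.baseChange K) ((2 ^ L : ℕ) : ℤ) ∧ Pm y ∧
    ((x : (W.baseChange K).sha) : (W.baseChange K).galH1) = torsionH1ToH1 (W.baseChange K) ((2 ^ L : ℕ) : ℤ) y}
  let U := AddSubgroup.closure genP
  let U' := AddSubgroup.closure genM
  have hUU' : ∀ u ∈ U, ∀ v ∈ U', B u v = 0 :=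
    forall_mem_closure_apply_eq_zero B genP genM fun x hx y hy ↦ hOrth x y hx hy
  have hfU : U₁.map f ≤ U := by
    rw [AddMonoidHom.map_closure]
    refine AddSubgroup.closure_mono ?_
    rintro _ ⟨x, ⟨-, hxP⟩, rfl⟩
    exact ⟨x, x.2.1, hxP, hf x⟩
  /- `#(ker f ⊓ U₁) ∣ 2`: the kernel is on the Kummer line `⟨δ g⟩` (sign `−w`), `U₁` has sign `w` -/
  have hkerf : Nat.card ↥(f.ker ⊓ U₁) ∣ 2 := by
    obtain ⟨c, hc⟩ := exists_addOrderOf_kummerMapTorsion_eq_two_pow (W.baseChange K) hdiv g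
    have hU₁sign : ∀ x ∈ U₁, conjAct W σ ((2 ^ L : ℕ) : ℤ) (x : galH1Torsion (W.baseChange K) ((2 ^ L : ℕ) : ℤ)) = w • (x : galH1Torsion (W.baseChange K) ((2 ^ L : ℕ) : ℤ)) := by
      intro x hx
      induction hx using AddSubgroup.closure_induction with
      | mem x hx => exact hx.1
      | zero => rw [ZeroMemClass.coe_zero, map_zero, zsmul_zero]
      | add x y _ _ hx hy => rw [AddMemClass.coe_add, map_add, hx, hy, zsmul_add]
      | neg x _ hx => rw [NegMemClass.coe_neg, map_neg, hx, zsmul_neg]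
    have hline : ∀ x : S₁, f x = 0 → (x : galH1Torsion (W.baseChange K) ((2 ^ L : ℕ) : ℤ)) ∈ zmultiples (kummerMapTorsion (W.baseChange K) ((2 ^ L : ℕ) : ℤ) hdiv g) := fun x hx ↦
      mem_zmultiples_kummer_of_torsionH1ToH1_eq_zero (W.baseChange K) ((2 ^ L : ℕ) : ℤ) hdiv g hg x (hfker x hx)
    have hline_sign : ∀ y ∈ zmultiples (kummerMapTorsion (W.baseChange K) ((2 ^ L : ℕ) : ℤ) hdiv g), conjAct W σ ((2 ^ L : ℕ) : ℤ) y = (-w) • y := by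
      intro y hy
      obtain ⟨j, rfl⟩ := mem_zmultiples_iff.mp hy
      rw [map_zsmul, hκ, smul_comm]
    have h2tor : ∀ x ∈ f.ker ⊓ U₁, 2 • (x : galH1Torsion (W.baseChange K) ((2 ^ L : ℕ) : ℤ)) = 0 := by
      rintro x ⟨hxk, hxU⟩
      have h1 := hU₁sign x hxU
      have h2 := hline_sign _ (hline x hxk)
      rw [h1] at h2
      rcases hw with rfl | rfl
      · rw [one_smul, neg_one_zsmul] at h2
        rw [two_nsmul]
        nth_rw 2 [h2]
        exact add_neg_cancel _
      · rw [neg_neg, one_smul, neg_one_zsmul] at h2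
        rw [two_nsmul]
        nth_rw 1 [← h2]
        exact neg_add_cancel _
    refine natCard_dvd_two_of_forall_eq _ fun x hx y hy hx0 hy0 ↦ Subtype.ext ?_
    have hx0' : (x : galH1Torsion (W.baseChange K) ((2 ^ L : ℕ) : ℤ)) ≠ 0 := fun h ↦ hx0 (Subtype.ext h)
    have hy0' : (y : galH1Torsion (W.baseChange K) ((2 ^ L : ℕ) : ℤ)) ≠ 0 := fun h ↦ hy0 (Subtype.ext h)
    exact eq_of_two_nsmul_eq_zero_of_mem_zmultiples hc (hline x hx.1) (hline y hy.1) hx0' hy0' (h2tor x hx) (h2tor y hy)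
  /- membership in `S₁` of a Selmer class of order `2^a`, `a ≤ k` -/
  have hmemS₁ : ∀ (y : galH1Torsion (W.baseChange K) ((2 ^ L : ℕ) : ℤ)) (a : ℕ), a ≤ k → y ∈ selmerGroup (W.baseChange K) ((2 ^ L : ℕ) : ℤ) →
      addOrderOf y = 2 ^ a → y ∈ S₁ := by
    intro y a ha hsel hord
    refine ⟨hsel, mem_torsionBy_iff.mpr ?_⟩
    rw [natCast_zsmul, ← addOrderOf_dvd_iff_nsmul_eq_zero, hord]
    exact pow_dvd_pow 2 ha
  /- the (+)-ladder, upstairs in `U₁` -/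
  have hfam : ∀ m < R, ∃ x : Fin (2 * m + 2) → S₁, (∀ i, x i ∈ U₁) ∧
      (∀ i, addOrderOf (x i) = 2 ^ (Mr (2 * m) - Mr (2 * m + 1))) ∧
      ∀ c : Fin (2 * m + 2) → ℤ, ∑ i, c i • x i = 0 → ∀ i, ((2 ^ (Mr (2 * m) - Mr (2 * m + 1)) : ℕ) : ℤ) ∣ c i := by
    intro m _
    rcases Nat.eq_zero_or_pos (Mr (2 * m) - Mr (2 * m + 1)) with h0 | hpos
    · refine ⟨fun _ ↦ 0, fun _ ↦ U₁.zero_mem, fun _ ↦ by rw [h0, pow_zero, addOrderOf_zero], fun c _ i ↦ ?_⟩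
      rw [h0, pow_zero, Nat.cast_one]
      exact one_dvd _
    · have hdrop : Mr (2 * m + 1) < Mr (2 * m) := by omega
      obtain ⟨z, hzP, hzord, hzind⟩ := exists_indepFamilyMod_of_forall_exists_avoiding
        (A := galH1Torsion (W.baseChange K) ((2 ^ L : ℕ) : ℤ)) (N := 2 ^ (Mr (2 * m) - Mr (2 * m + 1))) (s := 2 * m + 2)
        (fun y ↦ (y ∈ selmerGroup (W.baseChange K) ((2 ^ L : ℕ) : ℤ) ∧ conjAct W σ ((2 ^ L : ℕ) : ℤ) y = w • y) ∧ Pp y) ⊥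
        (fun i hi x hxP hxord _ ↦ by
          obtain ⟨y, hy, hyP, hyord, hyav⟩ := hsupOdd m hdrop i hi x (fun j ↦ (hxP j).1) hxord
          exact ⟨y, ⟨hy, hyP⟩, hyord, dvd_of_zsmul_add_sum_mem_of_disjoint ⊥ x hyord (by rwa [sup_bot_eq])⟩)
      have hzS : ∀ i, z i ∈ S₁ := fun i ↦
        hmemS₁ (z i) _ ((Nat.sub_le _ _).trans (hMrle _)) (hzP i).1.1 (hzord i)
      let z₁ : Fin (2 * m + 2) → S₁ := fun i ↦ ⟨z i, hzS i⟩
      have hcoe : ∀ e : Fin (2 * m + 2) → ℤ,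
          ((∑ i, e i • z₁ i : S₁) : galH1Torsion (W.baseChange K) ((2 ^ L : ℕ) : ℤ)) = ∑ i, e i • z i := fun e ↦ by
        simp only [z₁, AddSubmonoidClass.coe_finsetSum, AddSubgroupClass.coe_zsmul]
      refine ⟨z₁, fun i ↦ AddSubgroup.subset_closure ⟨(hzP i).1.2, (hzP i).2⟩, fun i ↦ ?_, fun c hc i ↦ ?_⟩
      · rw [← hzord i]
        exact (addOrderOf_injective S₁.subtype Subtype.coe_injective (z₁ i)).symm
      · exact indep_of_indepMod ⊥ z hzind c (by rw [← hcoe, hc, ZeroMemClass.coe_zero]) i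
  /- the (−)-ladder, pushed down to `U'` -/
  have hfam' : ∀ m < R, ∃ x : Fin (2 * m + 2) → ↥((↥(W.baseChange K).sha)[((2 ^ k : ℕ) : ℤ)]), (∀ i, x i ∈ U') ∧
      (∀ i, addOrderOf (x i) = 2 ^ (Mr (2 * m + 1) - Mr (2 * m + 2))) ∧
      ∀ c : Fin (2 * m + 2) → ℤ, ∑ i, c i • x i = 0 → ∀ i, ((2 ^ (Mr (2 * m + 1) - Mr (2 * m + 2)) : ℕ) : ℤ) ∣ c i := by
    intro m _
    rcases Nat.eq_zero_or_pos (Mr (2 * m + 1) - Mr (2 * m + 2)) with h0 | hpos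
    · refine ⟨fun _ ↦ 0, fun _ ↦ U'.zero_mem, fun _ ↦ by rw [h0, pow_zero, addOrderOf_zero], fun c _ i ↦ ?_⟩
      rw [h0, pow_zero, Nat.cast_one]
      exact one_dvd _
    · have hdrop : Mr (2 * m + 2) < Mr (2 * m + 1) := by omega
      obtain ⟨z, hzP, hzord, hzind⟩ := exists_indepFamilyMod_of_forall_exists_avoiding
        (A := galH1Torsion (W.baseChange K) ((2 ^ L : ℕ) : ℤ)) (N := 2 ^ (Mr (2 * m + 1) - Mr (2 * m + 2))) (s := 2 * m + 2)
        (fun y ↦ (y ∈ selmerGroup (W.baseChange K) ((2 ^ L : ℕ) : ℤ) ∧ conjAct W σ ((2 ^ L : ℕ) : ℤ) y = (-w) • y) ∧ Pm y) (zmultiples (kummerMapTorsion (W.baseChange K) ((2 ^ L : ℕ) : ℤ) hdiv P₀))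
        (fun i hi x hxP hxord _ ↦ by
          obtain ⟨y, hy, hyP, hyord, hyav⟩ := hsupEven m hdrop i hi x (fun j ↦ (hxP j).1) hxord
          exact ⟨y, ⟨hy, hyP⟩, hyord, dvd_of_zsmul_add_sum_mem_of_disjoint _ x hyord hyav⟩)
      have hzS : ∀ i, z i ∈ S₁ := fun i ↦
        hmemS₁ (z i) _ ((Nat.sub_le _ _).trans (hMrle _)) (hzP i).1.1 (hzord i)
      -- no loss along `Sel → Ш`: the span avoids the seed `⟨δ(P₀)⟩`, hence the whole Kummer line
      have hdisj : Disjoint (AddSubgroup.closure (Set.range z)) (zmultiples (kummerMapTorsion (W.baseChange K) ((2 ^ L : ℕ) : ℤ) hdiv P₀)) :=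
        disjoint_closure_range_of_indepMod _ z hzord hzind
      have hinj : ∀ e : Fin (2 * m + 2) → ℤ, torsionH1ToH1 (W.baseChange K) ((2 ^ L : ℕ) : ℤ) (∑ i, e i • z i) = 0 → ∑ i, e i • z i = 0 :=
        sum_zsmul_eq_zero_of_torsionH1ToH1_eq_zero_of_disjoint_kummer (W.baseChange K) hdiv g hg P₀ hP₀ z hdisj
      let z₁ : Fin (2 * m + 2) → S₁ := fun i ↦ ⟨z i, hzS i⟩
      have hcoe : ∀ e : Fin (2 * m + 2) → ℤ,
          ((∑ i, e i • z₁ i : S₁) : galH1Torsion (W.baseChange K) ((2 ^ L : ℕ) : ℤ)) = ∑ i, e i • z i := fun e ↦ by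
        simp only [z₁, AddSubmonoidClass.coe_finsetSum, AddSubgroupClass.coe_zsmul]
      have hinj₁ : ∀ e : Fin (2 * m + 2) → ℤ, f (∑ i, e i • z₁ i) = 0 → ∑ i, e i • z₁ i = 0 := fun e he ↦ by
        apply Subtype.ext
        rw [hcoe, ZeroMemClass.coe_zero]
        apply hinj e
        rw [← hcoe]
        exact hfker _ he
      have hrel : ∀ e : Fin (2 * m + 2) → ℤ, ∑ i, e i • f (z₁ i) = 0 ↔ ∑ i, e i • z₁ i = 0 :=
        sum_zsmul_map_eq_zero_iff_of_injOn_span f z₁ hinj₁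
      have hz₁ord : ∀ i, addOrderOf (z₁ i) = 2 ^ (Mr (2 * m + 1) - Mr (2 * m + 2)) := fun i ↦ by
        rw [← hzord i]
        exact (addOrderOf_injective S₁.subtype Subtype.coe_injective (z₁ i)).symm
      have hz₁ind : ∀ c : Fin (2 * m + 2) → ℤ, ∑ i, c i • z₁ i = 0 →
          ∀ i, ((2 ^ (Mr (2 * m + 1) - Mr (2 * m + 2)) : ℕ) : ℤ) ∣ c i := fun c hc ↦
        indep_of_indepMod _ z hzind c (by rw [← hcoe, hc, ZeroMemClass.coe_zero])
      refine ⟨fun i ↦ f (z₁ i), fun i ↦ AddSubgroup.subset_closure ⟨z i, (hzP i).1.1, (hzP i).2, hf _⟩, fun i ↦ ?_,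
        indep_of_forall_sum_zsmul_eq_zero_iff _ z₁ hrel hz₁ind⟩
      rw [addOrderOf_eq_of_forall_sum_zsmul_eq_zero_iff (fun i ↦ f (z₁ i)) z₁ hrel i, hz₁ord i]
  -- the count
  have h := pow_two_mul_dvd_natCard_sha_of_orthogonal_ladders_of_dvd_two (W.baseChange K) k B hker U U' hUU' f U₁ hfU hkerf
    heven R Mr hMr hMr2R hfam hfam'
  rwa [hMr0] at h

end Summit.BirchSwinnertonDyer.BirchSwinnertonDyer.Theorems.GenusExact.PlusDescent

end
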